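import Summits.BirchSwinnertonDyer.BirchSwinnertonDyer.Theorems.ResidualThetaTransportAtTwoRelativeLubinTateSeries
import Summits.BirchSwinnertonDyer.BirchSwinnertonDyer.Theorems.ResidualThetaTransportAtTwoUnramifiedQuadraticAtTwo
import Literature.NumberTheory.GaloisRepresentations.LubinTateTorsion
import HarnessLib

/-!
# `ℤ₄ := 𝒪_{ℚ₂(ζ₃)} ⊂ ℚ̄₂` IS a Lubin–Tate base for `(π, q) = (−2, 4)`: `LubinTate.IsLTRing (−2) 4` for the valuation ring
# `LubinTate.unitBall ℚ_[2]⟮ζ₃⟯` — the concrete coefficient ring on which `Ŵ ⊗ ℤ₄` is a formal `ℤ₄`-module (kernel)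

Route `ResidualThetaTransportAtTwo` (RTT), crux (R≥)ᵖ `ResidualThetaCountLowerPureAtTwo` (stmt-BirchSwinnertonDyer-26074); seat
`prover-bsd-wall-rtt-p2` g9 (`--supports`, closes nothing). Sequel of `…RelativeLubinTateSeries` (p608987: `isLTRing_of_isLocalRing`) and
`…UnramifiedQuadraticAtTwo` (p612711: `norm_pow_four_sub_self_le`, `a⁴ ≡ a (mod 2)` on `𝒪_{ℚ₂(ζ₃)}`). HONEST FRAMING: THEOREMS ONLY (no
definition, no named fact, no instance, no `sorry`); the carrier is the TREE's `Literature…LubinTate.unitBall` of Mathlib's intermediate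
field `ℚ_[2]⟮ζ⟯ ≤ PadicAlgCl 2` (the evaluation target of the Lubin–Tate points library and of TP2's `BallEval`); BSD is not proved by this.

WHAT (`ζ ∈ ℚ̄₂`, `ζ² + ζ + 1 = 0`; `E := ℚ_[2]⟮ζ⟯`, `𝒪 := LubinTate.unitBall E`):
* `norm_coe_unitBall_le` / bookkeeping, `not_isUnit_two`, `two_mem_maximalIdeal` (`‖2‖ = 2⁻¹ < 1`), `two_mul_eq_zero_imp`
  (`𝒪` is a domain), `two_dvd_pow_four_sub_self` (`2 ∣ a⁴ − a` in `𝒪`, from p612711);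
* **`isLTRing_unitBall_adjoin_zeta : LubinTate.IsLTRing (-(2 : 𝒪)) (2 ^ 2)`** — so parts II–IV (`formalGroupLaw_eq_ltF'`,
  `points_module_laws`, …) apply with `A = 𝒪_{ℚ₂(ζ₃)}`: for every Weierstrass model `U/𝒪` with `i([2]X) ≡ X⁴ (mod 2)` — e.g. the base
  change of a habitat curve's `ℤ₂`-model, or a CM curve over `ℚ₄` with `ψ(w) = −2` — `Û` is a formal `𝒪_{ℚ₂(ζ₃)}`-module with `[ζ₃]` of
  order `3` and `Gal(ℚ₄/ℚ₂)` acting semilinearly.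

References: [SerreLocalFields1979] Ch. I §6, Ch. IV §4; [CasselsFrohlichANT1967] Ch. VI §3.5 Remark 2; [LubinTate1965] §1.
-/

set_option autoImplicit false
-- the Theorems namespace of this sub repeats the summit name by design (D-0017 nested layout)
set_option linter.dupNamespace false

noncomputable section

open scoped Classical IntermediateField
open Literature.NumberTheory.GaloisRepresentations

namespace Summit.BirchSwinnertonDyer.BirchSwinnertonDyer.Theorems.RelativeLubinTate.ZFour

variable {ζ : PadicAlgCl 2} (hζ : ζ ^ 2 + ζ + 1 = 0)

/-- The norm of `ℚ_[2]⟮ζ⟯` is the restriction of the norm of `ℚ̄₂`. [folklore] -/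
theorem norm_coe_adjoin (x : ↥ℚ_[2]⟮ζ⟯) : ‖x‖ = ‖(x : PadicAlgCl 2)‖ := rfl

/-- `‖2‖ = 2⁻¹` in `ℚ_[2]⟮ζ⟯`. [folklore] -/
theorem norm_two_adjoin : ‖(2 : ↥ℚ_[2]⟮ζ⟯)‖ = 2⁻¹ := by
  rw [norm_coe_adjoin]
  have hc : ((2 : ↥ℚ_[2]⟮ζ⟯) : PadicAlgCl 2) = 2 := rfl
  rw [hc, ← map_ofNat (algebraMap ℚ_[2] (PadicAlgCl 2)) 2, PadicAlgCl.norm_extends]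
  have h := Padic.norm_p (p := 2)
  exact_mod_cast h

/-- `2` is not a unit of `𝒪 = LubinTate.unitBall ℚ_[2]⟮ζ⟯` (`‖2‖ < 1`, units have norm `1`). [folklore] -/
theorem not_isUnit_two : ¬ IsUnit (2 : LubinTate.unitBall (↥ℚ_[2]⟮ζ⟯)) := by
  rintro ⟨u, hu⟩
  have h1 : ((u : LubinTate.unitBall (↥ℚ_[2]⟮ζ⟯)) : ↥ℚ_[2]⟮ζ⟯) * ((u⁻¹ : (LubinTate.unitBall (↥ℚ_[2]⟮ζ⟯))ˣ) :
      LubinTate.unitBall (↥ℚ_[2]⟮ζ⟯)) = 1 := by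
    rw [← Subring.coe_mul, Units.mul_inv, Subring.coe_one]
  have hn := congrArg norm h1
  rw [norm_mul, norm_one, hu] at hn
  have h2 : ‖((2 : LubinTate.unitBall (↥ℚ_[2]⟮ζ⟯)) : ↥ℚ_[2]⟮ζ⟯)‖ = 2⁻¹ := by
    rw [show ((2 : LubinTate.unitBall (↥ℚ_[2]⟮ζ⟯)) : ↥ℚ_[2]⟮ζ⟯) = 2 from rfl]; exact norm_two_adjoin
  have hle : ‖(((u⁻¹ : (LubinTate.unitBall (↥ℚ_[2]⟮ζ⟯))ˣ) : LubinTate.unitBall (↥ℚ_[2]⟮ζ⟯)) : ↥ℚ_[2]⟮ζ⟯)‖ ≤ 1 :=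
    (LubinTate.mem_unitBall_iff _).mp (Subtype.mem _)
  rw [h2] at hn
  have : (2 : ℝ)⁻¹ * ‖(((u⁻¹ : (LubinTate.unitBall (↥ℚ_[2]⟮ζ⟯))ˣ) : LubinTate.unitBall (↥ℚ_[2]⟮ζ⟯)) : ↥ℚ_[2]⟮ζ⟯)‖ ≤ 2⁻¹ * 1 :=
    mul_le_mul_of_nonneg_left hle (by norm_num)
  rw [hn] at this
  norm_num at this

/-- `2 ∈ 𝔪_𝒪`. [folklore] -/
theorem two_mem_maximalIdeal :
    ((2 : ℕ) : LubinTate.unitBall (↥ℚ_[2]⟮ζ⟯)) ∈ IsLocalRing.maximalIdeal (LubinTate.unitBall (↥ℚ_[2]⟮ζ⟯)) := by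
  rw [Nat.cast_ofNat, IsLocalRing.mem_maximalIdeal, mem_nonunits_iff]
  exact not_isUnit_two

/-- `2` is regular in the domain `𝒪`. [folklore] -/
theorem two_mul_eq_zero_imp (x : LubinTate.unitBall (↥ℚ_[2]⟮ζ⟯)) (hx : ((2 : ℕ) : LubinTate.unitBall (↥ℚ_[2]⟮ζ⟯)) * x = 0) :
    x = 0 := by
  rw [Nat.cast_ofNat] at hx
  rcases mul_eq_zero.mp hx with h | h
  · exfalso
    have h' : (2 : ↥ℚ_[2]⟮ζ⟯) = 0 := by
      have := congrArg (fun t : LubinTate.unitBall (↥ℚ_[2]⟮ζ⟯) ↦ (t : ↥ℚ_[2]⟮ζ⟯)) h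
      exact this
    have hn := congrArg norm h'
    rw [norm_two_adjoin, norm_zero] at hn
    norm_num at hn
  · exact h

include hζ in
/-- **`2 ∣ a⁴ − a` in `𝒪_{ℚ₂(ζ₃)}`** (residue field `𝔽₄`): from `‖a⁴ − a‖ ≤ ‖2‖` (p612711 `norm_pow_four_sub_self_le`), the quotient
`(a⁴ − a)/2` lies in `𝒪`. [cite: SerreLocalFields1979, Ch. IV §4] -/
theorem two_dvd_pow_four_sub_self (a : LubinTate.unitBall (↥ℚ_[2]⟮ζ⟯)) :
    ((2 : ℕ) : LubinTate.unitBall (↥ℚ_[2]⟮ζ⟯)) ∣ a ^ (2 ^ 2) - a := by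
  rw [Nat.cast_ofNat]
  set aE : ↥ℚ_[2]⟮ζ⟯ := (a : ↥ℚ_[2]⟮ζ⟯) with haE
  have ha1 : ‖(aE : PadicAlgCl 2)‖ ≤ 1 := by
    rw [← norm_coe_adjoin]; exact (LubinTate.mem_unitBall_iff _).mp a.2
  have hmem : (aE : PadicAlgCl 2) ∈ ℚ_[2]⟮ζ⟯ := aE.2
  have hle := norm_pow_four_sub_self_le hζ hmem ha1
  have h2E : (2 : ↥ℚ_[2]⟮ζ⟯) ≠ 0 := by
    intro h; have := congrArg norm h; rw [norm_two_adjoin, norm_zero] at this; norm_num at this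
  -- the quotient `b = (a⁴ − a)/2 ∈ 𝒪`
  set b : ↥ℚ_[2]⟮ζ⟯ := (aE ^ 4 - aE) / 2 with hb
  have hb1 : ‖b‖ ≤ 1 := by
    rw [hb, norm_div, div_le_one (by rw [norm_two_adjoin]; norm_num), norm_coe_adjoin, norm_coe_adjoin]
    exact hle
  refine ⟨⟨b, (LubinTate.mem_unitBall_iff _).mpr hb1⟩, ?_⟩
  apply Subtype.ext
  change (aE ^ (2 ^ 2) - aE : ↥ℚ_[2]⟮ζ⟯) = 2 * b
  rw [hb, mul_div_cancel₀ _ h2E]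
  norm_num

include hζ in
/-- **`𝒪_{ℚ₂(ζ₃)}` is a Lubin–Tate base for `(−2, 4)`**: `LubinTate.IsLTRing (−2) 4` holds for `LubinTate.unitBall ℚ_[2]⟮ζ⟯` — the
concrete `ℤ₄` over which parts II–IV make `Ŵ ⊗ ℤ₄` a formal `ℤ₄`-module with `[ζ₃]` of order `3`.
[cite: CasselsFrohlichANT1967, Ch. VI §3.5 Remark 2] [cite: LubinTate1965, §1] -/
theorem isLTRing_unitBall_adjoin_zeta :
    LubinTate.IsLTRing (-((2 : ℕ) : LubinTate.unitBall (↥ℚ_[2]⟮ζ⟯))) (2 ^ 2) :=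
  isLTRing_of_isLocalRing 2 two_mem_maximalIdeal two_mul_eq_zero_imp (two_dvd_pow_four_sub_self hζ)

end Summit.BirchSwinnertonDyer.BirchSwinnertonDyer.Theorems.RelativeLubinTate.ZFour

end
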